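import Mathlib.Analysis.InnerProductSpace.Calculus
import Mathlib.Analysis.InnerProductSpace.PiL2
import Mathlib.Analysis.Calculus.ContDiff.Basic

/-!
# Crux `SelfMixingDichotomy.CoherentScaleExclusion` (stmt-NavierStokesRegularity-1423), line
  `registered`: joint smoothness of the kinematic swirl witness

Helper file (theorems only; lands `--supports stmt-NavierStokesRegularity-1423`) for the
registered stub `kinWitness_contDiffOn_swirlField` of the lead's skeleton. The KINEMATIC WITNESS
against the cascade stub of the crux is the space-time field

  `(t, x) ↦ (g t · φ (‖x‖² / h t)) • J x`,   `J x = (−x₁, x₀, 0)`,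

with `φ` smooth on `ℝ`, `g, h` smooth on an open time set `S` and `h ≠ 0` on `S`. This file proves
that the field is jointly `C^∞` on `S ×ˢ univ`: the scalar factor is a product/quotient/composite
of smooth maps (`ContDiffOn.mul`, `ContDiffOn.div`, `ContDiff.comp_contDiffOn`, `ContDiff.norm_sq`)
and the vector factor `p ↦ J p.2` is smooth coordinatewise (`contDiff_euclidean`, the coordinates
of `EuclideanSpace ℝ (Fin 3)` being continuous linear), so `ContDiffOn.smul` concludes.
-/

set_option linter.dupNamespace false

namespace Summit.NavierStokesRegularity.NavierStokesRegularity.Theorems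

/-- The coordinate maps `p ↦ p.2 j` on `ℝ × ℝ³` are smooth (continuous linear). [folklore] -/
theorem kinWitness_contDiffOn_snd_apply (j : Fin 3) {n : WithTop ℕ∞} :
    ContDiff ℝ n (fun p : ℝ × EuclideanSpace ℝ (Fin 3) => p.2 j) :=
  (EuclideanSpace.proj (𝕜 := ℝ) j).contDiff.comp contDiff_snd

/-- The rotation field `p ↦ J p.2 = (−x₁, x₀, 0)` (with `x = p.2`) is smooth on `ℝ × ℝ³`.
[folklore] -/
theorem kinWitness_contDiffOn_rotField {n : WithTop ℕ∞} :
    ContDiff ℝ n (fun p : ℝ × EuclideanSpace ℝ (Fin 3) =>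
      (WithLp.toLp 2 ![-(p.2 1), p.2 0, 0] : EuclideanSpace ℝ (Fin 3))) := by
  rw [contDiff_euclidean]
  intro i
  fin_cases i
  · simpa [PiLp.toLp_apply] using (kinWitness_contDiffOn_snd_apply 1 (n := n)).neg
  · simpa [PiLp.toLp_apply] using kinWitness_contDiffOn_snd_apply 0 (n := n)
  · simpa [PiLp.toLp_apply] using
      (contDiff_const : ContDiff ℝ n (fun _ : ℝ × EuclideanSpace ℝ (Fin 3) => (0 : ℝ)))

/-- **Joint smoothness of the kinematic swirl witness** (stub `kinWitness_contDiffOn_swirlField`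
of crux stmt-NavierStokesRegularity-1423, line `registered`): for `φ` smooth, `g, h` smooth on an
open set `S` with `h ≠ 0` on `S`, the space-time field
`(t, x) ↦ (g t · φ (‖x‖² / h t)) • (−x₁, x₀, 0)` is `C^∞` on `S ×ˢ univ`. Pure composition
calculus. [folklore] -/
theorem kinWitness_contDiffOn_swirlField : ∀ (φ : ℝ → ℝ), ContDiff ℝ (⊤ : ℕ∞) φ → ∀ (g h : ℝ → ℝ) (S : Set ℝ), IsOpen S → ContDiffOn ℝ (⊤ : ℕ∞) g S → ContDiffOn ℝ (⊤ : ℕ∞) h S → (∀ t ∈ S, h t ≠ 0) → ContDiffOn ℝ (⊤ : ℕ∞) (fun p : ℝ × EuclideanSpace ℝ (Fin 3) => (g p.1 * φ (‖p.2‖ ^ 2 / h p.1)) • (WithLp.toLp 2 ![-(p.2 1), p.2 0, 0] : EuclideanSpace ℝ (Fin 3))) (S ×ˢ Set.univ) := by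
  intro φ hφ g h S _ hg hh hh0
  have hfst : ∀ p ∈ S ×ˢ (Set.univ : Set (EuclideanSpace ℝ (Fin 3))), p.1 ∈ S :=
    fun p hp => (Set.mem_prod.1 hp).1
  have hgS : ContDiffOn ℝ (⊤ : ℕ∞) (fun p : ℝ × EuclideanSpace ℝ (Fin 3) => g p.1)
      (S ×ˢ Set.univ) :=
    hg.comp contDiff_fst.contDiffOn hfst
  have hhS : ContDiffOn ℝ (⊤ : ℕ∞) (fun p : ℝ × EuclideanSpace ℝ (Fin 3) => h p.1)
      (S ×ˢ Set.univ) :=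
    hh.comp contDiff_fst.contDiffOn hfst
  have hnorm : ContDiffOn ℝ (⊤ : ℕ∞) (fun p : ℝ × EuclideanSpace ℝ (Fin 3) => ‖p.2‖ ^ 2)
      (S ×ˢ Set.univ) :=
    (contDiff_snd.norm_sq ℝ).contDiffOn
  have hdiv : ContDiffOn ℝ (⊤ : ℕ∞)
      (fun p : ℝ × EuclideanSpace ℝ (Fin 3) => ‖p.2‖ ^ 2 / h p.1) (S ×ˢ Set.univ) :=
    hnorm.div hhS fun p hp => hh0 p.1 (hfst p hp)
  have hscal : ContDiffOn ℝ (⊤ : ℕ∞)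
      (fun p : ℝ × EuclideanSpace ℝ (Fin 3) => g p.1 * φ (‖p.2‖ ^ 2 / h p.1)) (S ×ˢ Set.univ) :=
    hgS.mul (hφ.comp_contDiffOn hdiv)
  exact hscal.smul kinWitness_contDiffOn_rotField.contDiffOn

end Summit.NavierStokesRegularity.NavierStokesRegularity.Theorems
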